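import Summits.Langlands.Langlands.Theorems.PhantomRMYoshidaResiduallyYoshidaLiftingKlingenReduction
import Summits.Langlands.Langlands.Theorems.PhantomRMYoshidaResiduallyYoshidaLiftingSplit
import HarnessLib

/-!
# Route `PhantomRMYoshida`, crux `ResiduallyYoshidaLifting` (stmt-Langlands-13639), line `sector-klingen-split`,
# skeleton rev 6: the three ANCHORED open stubs are implied by the CRUX itself

Lead prover-line-stmt-Langlands-13639-c3-0 (2026-08-17), rev 6 (the relative skeleton over the strategist s1's anchored split glue
`RelSectorSplit.ResiduallyYoshidaLifting_of_relSubs`).  The anchored stubs `stub_selmerAnchorRel` (R1c-rel), `stub_cornerThreeRel`,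
`stub_cornerTwistRel` each carry the crux's relative hypothesis (an automorphic irreducible `Sh`-point `ρ₀` on the fibre), so each is
implied by the CRUX `ResiduallyYoshidaLifting` — not merely by the route target: under the crux the irreducible `Sh`-point at hand is
automorphic (oddness from `DetC`), hence its own Klingen-shape realiser (`c = 1`) and its own Klingen approximant
(`isKlingenClassicalLimit_of_aut`, p116982).  Registered sub-goals `stub_selmerAnchorRel_of_crux`, `stub_cornerThreeRel_of_crux`,
`stub_cornerTwistRel_of_crux`.  Nothing is asserted: the crux enters only as a hypothesis.  (The two remaining open stubs of rev 6,
`stub_nonsplitPropagationKlingen` and `stub_klingenLimitClassicality`, are ≤ the route target: p148056, p116982.)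
-/

noncomputable section

-- `Summit.Langlands.Langlands.…` (summit = sub-problem name, D-0017 layout) trips `dupNamespace` on every decl.
set_option linter.dupNamespace false
set_option autoImplicit false

open IsDedekindDomain Filter
open Literature.NumberTheory.GaloisRepresentations Literature.NumberTheory.Automorphic
open Summit.Langlands.Langlands.Cruxes.ResiduallyYoshidaLifting.YoshidaDivisorSelmerCount
open Summit.Langlands.Langlands.Cruxes.ResiduallyYoshidaLifting.SectorSplit

namespace Summit.Langlands.Langlands.Cruxes.ResiduallyYoshidaLifting.SectorKlingenSplit

/-- **R1c-rel ≤ crux** (registered sub-goal `stub_selmerAnchorRel_of_crux`): under the crux the realising irreducible `Sh`-point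
`ρ` is automorphic (the anchor `ρ₀` of the hypothesis feeds the crux) and is itself the Klingen-shape witness (`c = 1`, the `Sh`
multiplier, the same realisation triple). -/
theorem stub_selmerAnchorRel_of_crux :
    Summit.Langlands.Langlands.Theses.PhantomRMYoshida.ResiduallyYoshidaLifting → (∀ (p : ℕ) [Fact p.Prime], p ≠ 2 → ∀
    (k : Type) [Field k] [CharP k p] [IsAlgClosed k] [TopologicalSpace k] [DiscreteTopology k] (red : Valued.integer
    (PadicAlgCl p) →+* k) (σ σ' : FramedGaloisRep ℚ k 2) (hcpt : isCompact_glFiniteIntegralLevel 4 ℚ) (ι : PadicAlgCl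
    p ≃+* ℂ) (B : Field.absoluteGaloisGroup ℚ → Matrix (Fin 2) (Fin 2) k), σ.toGaloisRep.IsIrreducible →
    σ'.toGaloisRep.IsIrreducible → DetC p k σ σ' → (¬ ∃ g : GL (Fin 2) k, ∀ x, g * σ x * g⁻¹ = σ' x) → GenericSector p
    k σ σ' → (∃ ρ₀ : FramedGaloisRep ℚ (PadicAlgCl p) 4, ρ₀.toGaloisRep.IsIrreducible ∧ Sh p k red σ σ' ρ₀ ∧ Aut p
    hcpt ι ρ₀) → (¬ ∃ X : Matrix (Fin 2) (Fin 2) k, ∀ g, B g = (σ g).val * X - X * (σ' g).val) → (∃ ρ :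
    FramedGaloisRep ℚ (PadicAlgCl p) 4, ρ.toGaloisRep.IsIrreducible ∧ Sh p k red σ σ' ρ ∧ ∃ (P : GL (Fin 4)
    (PadicAlgCl p)) (rint : Field.absoluteGaloisGroup ℚ →* GL (Fin 4) (Valued.integer (PadicAlgCl p))) (h : GL (Fin 4)
    k), (∀ g, Matrix.GeneralLinearGroup.map (Valued.integer (PadicAlgCl p)).subtype (rint g) = P⁻¹ * ρ g * P) ∧ (∀ g,
    (Matrix.GeneralLinearGroup.map red (rint g)).val = h.val * Matrix.reindex finSumFinEquiv finSumFinEquiv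
    (Matrix.fromBlocks (σ g).val (B g) 0 (σ' g).val) * (h⁻¹).val)) → ∃ ρ₁ : FramedGaloisRep ℚ (PadicAlgCl p) 4,
    ρ₁.toGaloisRep.IsIrreducible ∧ Aut p hcpt ι ρ₁ ∧ (∃ c : ℕ, (c : ZMod (p - 1)) = 1 ∧ (∃ ν :
    Field.absoluteGaloisGroup ℚ → PadicAlgCl p, ρ₁.IsSymplecticWithMultiplierFun ν) ∧ ∀ v : HeightOneSpectrum
    (NumberField.RingOfIntegers ℚ), ((p : ℕ) : NumberField.RingOfIntegers ℚ) ∈ v.asIdeal →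
    ρ₁.IsGreenbergOrdinaryOfShapeAt v ![0, 0, c, c] ∧ ρ₁.IsResiduallyDistinguishedAt v ![0, 0, c, c]) ∧ ∃ (P : GL (Fin
    4) (PadicAlgCl p)) (rint : Field.absoluteGaloisGroup ℚ →* GL (Fin 4) (Valued.integer (PadicAlgCl p))) (h : GL (Fin
    4) k), (∀ g, Matrix.GeneralLinearGroup.map (Valued.integer (PadicAlgCl p)).subtype (rint g) = P⁻¹ * ρ₁ g * P) ∧ (∀
    g, (Matrix.GeneralLinearGroup.map red (rint g)).val = h.val * Matrix.reindex finSumFinEquiv finSumFinEquiv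
    (Matrix.fromBlocks (σ g).val (B g) 0 (σ' g).val) * (h⁻¹).val)) := by
  intro hC p _ hp k _ _ _ _ _ red σ σ' hcpt ι B hσ hσ' hdet hnc _hG hanch _hncB hreal
  obtain ⟨ρ₀, hρ₀, hSh₀, hA₀⟩ := hanch
  obtain ⟨ρ, hρ, hSh, P, rint, h, hfr, hred⟩ := hreal
  have hAut : Aut p hcpt ι ρ :=
    hC p hp k red σ σ' hcpt ι ρ₀ ρ (isOdd_of_detC hdet).1 (isOdd_of_detC hdet).2 hσ hσ' hdet hnc hρ₀ hSh₀ hA₀ hρ hSh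
  refine ⟨ρ, hρ, hAut, ⟨1, by simp, ⟨_, hSh.1⟩, fun v hv => hSh.2.1 v hv⟩, P, rint, h, hfr, hred⟩

/-- **corner-3-rel ≤ crux** (registered sub-goal `stub_cornerThreeRel_of_crux`): under the crux every irreducible `Sh`-point on an
anchored fibre is automorphic, hence its own Klingen approximant; `p = 3 ≠ 2`. -/
theorem stub_cornerThreeRel_of_crux :
    Summit.Langlands.Langlands.Theses.PhantomRMYoshida.ResiduallyYoshidaLifting → (∀ (p : ℕ) [Fact p.Prime], p = 3 → ∀
    (k : Type) [Field k] [CharP k p] [IsAlgClosed k] [TopologicalSpace k] [DiscreteTopology k] (red : Valued.integer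
    (PadicAlgCl p) →+* k) (σ σ' : FramedGaloisRep ℚ k 2) (hcpt : isCompact_glFiniteIntegralLevel 4 ℚ) (ι : PadicAlgCl
    p ≃+* ℂ) (ρ₀ ρ : FramedGaloisRep ℚ (PadicAlgCl p) 4), σ.toGaloisRep.IsIrreducible → σ'.toGaloisRep.IsIrreducible →
    DetC p k σ σ' → (¬ ∃ g : GL (Fin 2) k, ∀ x, g * σ x * g⁻¹ = σ' x) → ρ₀.toGaloisRep.IsIrreducible → Sh p k red σ σ'
    ρ₀ → Aut p hcpt ι ρ₀ → ρ.toGaloisRep.IsIrreducible → Sh p k red σ σ' ρ → IsKlingenClassicalLimit p hcpt ι ρ) := by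
  intro hC p _ hp3 k _ _ _ _ _ red σ σ' hcpt ι ρ₀ ρ hσ hσ' hdet hnc hρ₀ hSh₀ hA₀ hρ hSh
  have hp : p ≠ 2 := by omega
  exact isKlingenClassicalLimit_of_aut hSh
    (hC p hp k red σ σ' hcpt ι ρ₀ ρ (isOdd_of_detC hdet).1 (isOdd_of_detC hdet).2 hσ hσ' hdet hnc hρ₀ hSh₀ hA₀ hρ hSh)

/-- **corner-twist-rel ≤ crux** (registered sub-goal `stub_cornerTwistRel_of_crux`): as above; `5 ≤ p` gives `p ≠ 2` and the
twist-pair hypothesis is not consumed. -/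
theorem stub_cornerTwistRel_of_crux :
    Summit.Langlands.Langlands.Theses.PhantomRMYoshida.ResiduallyYoshidaLifting → (∀ (p : ℕ) [Fact p.Prime], 5 ≤ p → ∀
    (k : Type) [Field k] [CharP k p] [IsAlgClosed k] [TopologicalSpace k] [DiscreteTopology k] (red : Valued.integer
    (PadicAlgCl p) →+* k) (σ σ' : FramedGaloisRep ℚ k 2) (hcpt : isCompact_glFiniteIntegralLevel 4 ℚ) (ι : PadicAlgCl
    p ≃+* ℂ) (ρ₀ ρ : FramedGaloisRep ℚ (PadicAlgCl p) 4), σ.toGaloisRep.IsIrreducible → σ'.toGaloisRep.IsIrreducible →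
    DetC p k σ σ' → (¬ ∃ g : GL (Fin 2) k, ∀ x, g * σ x * g⁻¹ = σ' x) → (∃ g : GL (Fin 2) k, ∀ x, ∃ c : k, (g * σ x *
    g⁻¹).val = c • (σ' x).val) → ρ₀.toGaloisRep.IsIrreducible → Sh p k red σ σ' ρ₀ → Aut p hcpt ι ρ₀ →
    ρ.toGaloisRep.IsIrreducible → Sh p k red σ σ' ρ → IsKlingenClassicalLimit p hcpt ι ρ) := by
  intro hC p _ hp5 k _ _ _ _ _ red σ σ' hcpt ι ρ₀ ρ hσ hσ' hdet hnc _htw hρ₀ hSh₀ hA₀ hρ hSh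
  have hp : p ≠ 2 := by omega
  exact isKlingenClassicalLimit_of_aut hSh
    (hC p hp k red σ σ' hcpt ι ρ₀ ρ (isOdd_of_detC hdet).1 (isOdd_of_detC hdet).2 hσ hσ' hdet hnc hρ₀ hSh₀ hA₀ hρ hSh)

end Summit.Langlands.Langlands.Cruxes.ResiduallyYoshidaLifting.SectorKlingenSplit

end
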